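import Summits.Ventures.HodgeKum4.Theorems.KummerFixedLocusOrbitSpan
import Summits.Ventures.HodgeKum4.Theorems.KummerFixedLocusInvolutionTrace
import Summits.Ventures.HodgeKum4.Theorems.KummerFixedLocusSignatureAdditivity
import HarnessLib

/-!
# `G`-signature bookkeeping: `σ(B(·, ι ·)) = σ(B) − dim 𝒦` (atom A7; cell `hodge-kum4`, seat p2)

HONEST FRAMING.  Pure linear algebra over a linearly ordered field, PROVED; no named fact; nothing
about the Hodge conjecture is asserted.

Setting: `V` finite-dimensional over a linearly ordered field `𝕜`, `B` a symmetric bilinear form,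
`G` a finite group of ODD order acting on `V` by `B`-isometries (`ρ`), `ι` a linear involution with
`ι ρ(g) = ρ(g⁻¹) ι` which FIXES the invariants `V^G` pointwise (no isometry hypothesis on `ι` is
needed for the identity below), and `B` POSITIVE DEFINITE on the augmentation submodule
`𝒦 = span{ρ(g)v − v}`.  Then, with
`σ(Q) = σ₊(Q) − σ₋(Q)` (Mathlib `QuadraticForm.sigPos/sigNeg`) and `B_ι(x, y) = B(x, ι y)`:

  `σ(B_ι) = σ(B) − dim 𝒦`   (`sig_twist_eq_sig_sub_finrank`).

This is the algebra of G2-AUDIT §A5′: `V = H⁸(X; ℝ)`, `G = Γ`, `ι` the Kummer involution,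
`σ(B_ι) = Sign(ι, X)` (the `G`-signature, to be identified with `[W_0]²` by the
Atiyah–Singer/Hirzebruch theorem — a named fact, not here), `σ(B) = σ(X) = 630` (Hodge index +
Göttsche–Soergel — named facts), `dim 𝒦 = 624` (F_Γ), `B > 0` on `𝒦` (Hodge–Riemann — named
fact), `ι = +1` on `H⁸(X)^Γ` (from L1 + Oguiso); output `Sign(ι, X) = 6`.

Proof: `V = V^G ⊕ 𝒦` `B`- and `B_ι`-orthogonally (averaging; invariance); `B_ι = B` on `V^G`;
on `𝒦`, `𝒦 = 𝒦₊ ⊕ 𝒦₋` (`ι`-eigenspaces) `B_ι`-orthogonally with `B_ι = ±B` definite of rank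
`dim 𝒦±`, and `dim 𝒦₊ = dim 𝒦₋` (`finrank_coinvariantsKer_involution_balance`: `tr(ι|𝒦) = 0`);
signatures add over orthogonal sums (`Signature.sigPos_eq_add_of_isCompl_isOrtho`).
-/

namespace Summit.Ventures.HodgeKum4.Signature

open Representation QuadraticMap QuadraticForm OrbitSpan

variable {𝕜 : Type*} [Field 𝕜] [LinearOrder 𝕜] [IsStrictOrderedRing 𝕜]
variable {G V : Type*} [Group G] [Fintype G] [AddCommGroup V] [Module 𝕜 V] [FiniteDimensional 𝕜 V]

omit [FiniteDimensional 𝕜 V] in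
/-- `V = V^G ⊕ 𝒦` for a finite group over a field of characteristic `0` (Reynolds averaging). -/
theorem isCompl_invariants_coinvariantsKer (ρ : Representation 𝕜 G V) :
    IsCompl ρ.invariants (Coinvariants.ker ρ) := by
  letI : Invertible (Fintype.card G : 𝕜) :=
    invertibleOfNonzero (by exact_mod_cast Fintype.card_ne_zero)
  refine isCompl_iff.2 ⟨Submodule.disjoint_def.2 fun x hxU hxK => ?_,
    codisjoint_iff.2 (eq_top_iff.2 fun x _ => ?_)⟩
  · have h1 : ρ.averageMap x = x := ρ.averageMap_id x hxU
    have h2 : ρ.averageMap x = 0 := by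
      have h3 : ρ.averageMap x = ⅟(Fintype.card G : 𝕜) • (∑ g : G, ρ g) x := by
        simp [GroupAlgebra.average, map_sum, LinearMap.sum_apply]
      rw [h3, sum_apply_eq_zero_of_mem_coinvariantsKer ρ hxK, smul_zero]
    rw [← h1, h2]
  · have hx : x = ρ.averageMap x + (x - ρ.averageMap x) := by abel
    rw [hx]
    exact Submodule.add_mem_sup (ρ.averageMap_invariant x) (sub_averageMap_mem_coinvariantsKer ρ x)

omit [LinearOrder 𝕜] [IsStrictOrderedRing 𝕜] [Fintype G] [FiniteDimensional 𝕜 V] in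
/-- `B(V^G, 𝒦) = 0` for a `G`-invariant bilinear form:
`B(u, ρ(g)v − v) = B(ρ(g⁻¹)u, v) − B(u, v) = 0`. -/
theorem bilin_invariants_coinvariantsKer_eq_zero (ρ : Representation 𝕜 G V)
    (B : LinearMap.BilinForm 𝕜 V) (hBinv : ∀ g x y, B (ρ g x) (ρ g y) = B x y)
    {u : V} (hu : u ∈ ρ.invariants) {k : V} (hk : k ∈ Coinvariants.ker ρ) : B u k = 0 := by
  rw [Representation.mem_invariants] at hu
  unfold Coinvariants.ker at hk
  refine Submodule.span_induction (p := fun k _ => B u k = 0) ?_ ?_ ?_ ?_ hk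
  · rintro _ ⟨⟨g, v⟩, rfl⟩
    change B u (ρ g v - v) = 0
    rw [map_sub, sub_eq_zero]
    calc B u (ρ g v) = B (ρ g (ρ g⁻¹ u)) (ρ g v) := by rw [hu g⁻¹, hu g]
      _ = B (ρ g⁻¹ u) v := hBinv g _ _
      _ = B u v := by rw [hu g⁻¹]
  · simp
  · intro x y _ _ hx hy
    rw [map_add, hx, hy, add_zero]
  · intro a x _ hx
    rw [map_smul, hx, smul_eq_mul, mul_zero]

/-- **`G`-signature bookkeeping: `σ(B_ι) = σ(B) − dim 𝒦`.** -/
theorem sig_twist_eq_sig_sub_finrank (hodd : (Nat.card G).Coprime 2)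
    (ρ : Representation 𝕜 G V) (B : LinearMap.BilinForm 𝕜 V)
    (hBsymm : ∀ x y, B x y = B y x) (hBinv : ∀ g x y, B (ρ g x) (ρ g y) = B x y)
    (ι : V →ₗ[𝕜] V) (hι2 : ι ∘ₗ ι = LinearMap.id)
    (hιρ : ∀ g : G, ι ∘ₗ ρ g = ρ g⁻¹ ∘ₗ ι) (hfix : ∀ x ∈ ρ.invariants, ι x = x)
    (hpos : ∀ x ∈ Coinvariants.ker ρ, x ≠ 0 → 0 < B x x) :
    ((sigPos (LinearMap.BilinMap.toQuadraticMap (B.compl₂ ι)) : ℤ) -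
        sigNeg (LinearMap.BilinMap.toQuadraticMap (B.compl₂ ι))) =
      (sigPos B.toQuadraticMap : ℤ) - sigNeg B.toQuadraticMap -
        Module.finrank 𝕜 (Coinvariants.ker ρ) := by
  -- notation
  set U : Submodule 𝕜 V := ρ.invariants with hUdef
  set K : Submodule 𝕜 V := Coinvariants.ker ρ with hKdef
  set Q : QuadraticForm 𝕜 V := B.toQuadraticMap with hQdef
  set Qι : QuadraticForm 𝕜 V := LinearMap.BilinMap.toQuadraticMap (B.compl₂ ι) with hQιdef
  have hQ : ∀ x, Q x = B x x := fun x => rfl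
  have hQι : ∀ x, Qι x = B x (ι x) := fun x => rfl
  have hιι : ∀ x, ι (ι x) = x := fun x => LinearMap.congr_fun hι2 x
  have hιK : Set.MapsTo ι (K : Set V) (K : Set V) := coinvariantsKer_mapsTo_of_conj ρ ι hιρ
  -- (a) the decomposition and orthogonality
  have hUK : IsCompl U K := isCompl_invariants_coinvariantsKer ρ
  have hB0 : ∀ u ∈ U, ∀ k ∈ K, B u k = 0 := fun u hu k hk =>
    bilin_invariants_coinvariantsKer_eq_zero ρ B hBinv hu hk
  have hB0' : ∀ u ∈ U, ∀ k ∈ K, B k u = 0 := fun u hu k hk => by rw [hBsymm]; exact hB0 u hu k hk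
  have hQorth : ∀ u ∈ U, ∀ k ∈ K, Q.IsOrtho u k := by
    intro u hu k hk
    rw [QuadraticMap.isOrtho_def, hQ, hQ, hQ, map_add, map_add, LinearMap.add_apply,
      LinearMap.add_apply, hB0 u hu k hk, hB0' u hu k hk]
    ring
  have hQιorth : ∀ u ∈ U, ∀ k ∈ K, Qι.IsOrtho u k := by
    intro u hu k hk
    rw [QuadraticMap.isOrtho_def, hQι, hQι, hQι, map_add, map_add, map_add, LinearMap.add_apply,
      LinearMap.add_apply, hfix u hu, hB0 u hu (ι k) (hιK hk), hB0' u hu k hk]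
    ring
  -- (b) on U the two forms agree
  have hU_eq : Qι.restrict U = Q.restrict U := by
    ext x
    rw [QuadraticMap.restrict_apply, QuadraticMap.restrict_apply, hQι, hQ, hfix x x.2]
  -- (c) on K: Q is positive definite
  have hQK : (Q.restrict K).PosDef := by
    intro x hx
    rw [QuadraticMap.restrict_apply, hQ]
    exact hpos x x.2 fun h0 => hx (Subtype.ext h0)
  -- (d) on K: eigenspace decomposition for ι
  set ιK : K →ₗ[𝕜] K := ι.restrict hιK with hιKdef
  have hιKι : ∀ x : K, ((ιK x : K) : V) = ι x := fun x => rfl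
  set Kp : Submodule 𝕜 K := LinearMap.ker (ιK - LinearMap.id) with hKp
  set Km : Submodule 𝕜 K := LinearMap.ker (ιK + LinearMap.id) with hKm
  have hmemKp : ∀ {x : K}, x ∈ Kp ↔ ι (x : V) = x := by
    intro x
    rw [hKp, LinearMap.mem_ker, LinearMap.sub_apply, sub_eq_zero, LinearMap.id_apply,
      Subtype.ext_iff, hιKι]
  have hmemKm : ∀ {x : K}, x ∈ Km ↔ ι (x : V) = -x := by
    intro x
    rw [hKm, LinearMap.mem_ker, LinearMap.add_apply, add_eq_zero_iff_eq_neg, LinearMap.id_apply,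
      Subtype.ext_iff, hιKι, NegMemClass.coe_neg]
  have hKpm : IsCompl Kp Km := by
    refine isCompl_iff.2 ⟨Submodule.disjoint_def.2 fun x hp hm => ?_,
      codisjoint_iff.2 (eq_top_iff.2 fun x _ => ?_)⟩
    · have h1 := hmemKp.1 hp
      have h2 := hmemKm.1 hm
      rw [h1] at h2
      have h3 : (2 : 𝕜) • (x : V) = 0 := by rw [two_smul]; nth_rewrite 1 [h2]; exact neg_add_cancel _
      rw [smul_eq_zero] at h3
      exact Subtype.ext (h3.resolve_left two_ne_zero)
    · have hx : x = (2 : 𝕜)⁻¹ • (x + ιK x) + (2 : 𝕜)⁻¹ • (x - ιK x) := by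
        rw [← smul_add, add_add_sub_cancel, ← two_smul 𝕜 x, smul_smul, inv_mul_cancel₀ two_ne_zero,
          one_smul]
      rw [hx]
      refine Submodule.add_mem_sup (Submodule.smul_mem _ _ ?_) (Submodule.smul_mem _ _ ?_)
      · rw [hmemKp]
        simp only [Submodule.coe_add, hιKι, map_add, hιι]
        exact add_comm _ _
      · rw [hmemKm]
        simp only [Submodule.coe_sub, hιKι, map_sub, hιι, neg_sub]
  have hQιKorth : ∀ a ∈ Kp, ∀ b ∈ Km, (Qι.restrict K).IsOrtho a b := by
    intro a ha b hb
    have ha' := hmemKp.1 ha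
    have hb' := hmemKm.1 hb
    simp only [QuadraticMap.isOrtho_def, QuadraticMap.restrict_apply, hQι, Submodule.coe_add,
      map_add, map_neg, LinearMap.add_apply, ha', hb']
    linear_combination hBsymm (b : V) (a : V)
  -- (e) the pieces on K
  have hKp_pos : ((Qι.restrict K).restrict Kp).PosDef := by
    intro a ha
    rw [QuadraticMap.restrict_apply, QuadraticMap.restrict_apply, hQι, hmemKp.1 a.2]
    exact hpos _ (a : K).2 fun h0 => ha (Subtype.ext (Subtype.ext h0))
  have hKm_neg : (-((Qι.restrict K).restrict Km)).PosDef := by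
    intro b hb
    rw [QuadraticMap.neg_apply, QuadraticMap.restrict_apply, QuadraticMap.restrict_apply, hQι,
      hmemKm.1 b.2, map_neg, neg_neg]
    exact hpos _ (b : K).2 fun h0 => hb (Subtype.ext (Subtype.ext h0))
  have hbal : Module.finrank 𝕜 Kp = Module.finrank 𝕜 Km :=
    finrank_coinvariantsKer_involution_balance hodd ρ ι hιρ hι2
  -- (f) assemble
  have e1 := sigPos_eq_add_of_isCompl_isOrtho Q U K hUK hQorth
  have e2 := sigNeg_eq_add_of_isCompl_isOrtho Q U K hUK hQorth
  have e3 := sigPos_eq_add_of_isCompl_isOrtho Qι U K hUK hQιorth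
  have e4 := sigNeg_eq_add_of_isCompl_isOrtho Qι U K hUK hQιorth
  have e5 := sigPos_eq_add_of_isCompl_isOrtho (Qι.restrict K) Kp Km hKpm hQιKorth
  have e6 := sigNeg_eq_add_of_isCompl_isOrtho (Qι.restrict K) Kp Km hKpm hQιKorth
  have f1 : sigPos (Q.restrict K) = Module.finrank 𝕜 K := sigPos_eq_finrank_of_posDef hQK
  have f2 : sigNeg (Q.restrict K) = 0 := sigNeg_eq_zero_of_posDef hQK
  have f3 : sigPos ((Qι.restrict K).restrict Kp) = Module.finrank 𝕜 Kp :=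
    sigPos_eq_finrank_of_posDef hKp_pos
  have f4 : sigNeg ((Qι.restrict K).restrict Kp) = 0 := sigNeg_eq_zero_of_posDef hKp_pos
  have f5 : sigNeg ((Qι.restrict K).restrict Km) = Module.finrank 𝕜 Km := by
    unfold sigNeg
    exact sigPos_eq_finrank_of_posDef hKm_neg
  have hnn : ∀ x ∈ K, 0 ≤ B x x := fun x hx => by
    by_cases h0 : x = 0
    · simp [h0]
    · exact (hpos x hx h0).le
  have f6 : sigPos ((Qι.restrict K).restrict Km) = 0 := by
    have h := QuadraticForm.sigPos_add_finrank_le_of_nonpos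
      (Q := (Qι.restrict K).restrict Km) (V := ⊤) (fun b _ => by
        rw [QuadraticMap.restrict_apply, QuadraticMap.restrict_apply, hQι, hmemKm.1 b.2, map_neg]
        exact neg_nonpos.2 (hnn _ (b : K).2))
    rw [finrank_top] at h
    omega
  rw [e1, e2, e3, e4, e5, e6, hU_eq, f1, f2, f3, f4, f5, f6, hbal]
  push_cast
  ring

end Summit.Ventures.HodgeKum4.Signature
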